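import Summits.QuantumFields.YangMills.Theorems.AlphaInputsT3ACv3OneBlockLift
import HarnessLib

/-!
# `AlphaInputsT3ACv3OneBlockLiftShapes` — (r1-ob) THE ONE-BLOCK LIFT, PART 3a: bounds of the 1D shapes (the mean-one tent and the centre bump, hosted in the home window) — lane
# `pub-balaban3d` ∕ cell `ym3-torus`, seat alpha-2 (g6)

WHY.  The sup, support and curl letters of the one-block kernel (`…v3OneBlockLiftBounds`, `…v3OneBlockLiftCurl`) reduce to three facts per 1D shape: a sup bound, the vanishing on
the two boundary offsets of the window, and a one-step Lipschitz bound along the cyclic offset.  THIS FILE (block size `n = 2m + 1`, `m ≥ 1`; period `N = n·n_c`, `n_c ≥ 2`):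
`tentW_le`, `tentZ_ge` (`≥ m(m+1)/2`), `tentV_mem` (`0 ≤ tentV ≤ 4`), `abs_tentV_step_le` (`≤ 12/n`), `tentV_zero_last`, `bumpV_facts` (values in `[0,1]`, boundary zeros, step
`≤ 3/n`), ★ `abs_hosted_step_le` (a hosted shape vanishing on the boundary offsets moves by at most its in-window Lipschitz constant along one cyclic step), `tS_facts`, `bumpS_facts`.
HONEST FRAMING.  Elementary real inequalities; count-neutral helper toward the (FL)∕KIN row `hLift` of R3 2′∕2′χ (items 19935∕19936 — NOT proved here); registry untouched; nothing
about d = 4, the continuum, or a mass gap; YM₃ on T³ is rung R3, not Clay.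

References: T. Bałaban, Commun. Math. Phys. 109 (1987) 249–301 [Balaban1987RG1] ((0.3) p.252); CMP 102 (1985) 277–309 [Balaban1985Variational] ((8) p.279).
-/

set_option autoImplicit false

noncomputable section

namespace Summit.QuantumFields.YangMills.Theorems.AbelianEML.OneBlock

open scoped BigOperators
open Literature.MathematicalPhysics.QuantumFieldTheory.Balaban1983to89
open Literature.MathematicalPhysics.QuantumFieldTheory.Balaban1983to89.T3ContinuumYM3Torus
open Literature.MathematicalPhysics.QuantumFieldTheory.Balaban1983to89.B10Eq38TorusDomains (toFine)
open Summit.QuantumFields.YangMills.Theorems.AbelianEML.Shapes1D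

/-! ## §1 1D shape bounds (`n = 2m + 1`, `m ≥ 1`) -/

section OneD

variable {n m : ℕ} (hnm : n = 2 * m + 1) (hm : 1 ≤ m)

/-- `tentW n r ≤ m`. [folklore] -/
theorem tentW_le (hnm : n = 2 * m + 1) (r : ℕ) : tentW n r ≤ m := by
  unfold tentW
  have : min r (n - 1 - r) ≤ m := by
    rcases Nat.lt_or_ge m r with h | h
    · exact (min_le_right _ _).trans (by omega)
    · exact (min_le_left _ _).trans h
  exact_mod_cast this

include hnm in
/-- `tentZ n ≥ m(m+1)/2` (the first half of the tent alone). [folklore] -/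
theorem tentZ_ge : ((m : ℝ) * ((m : ℝ) + 1)) / 2 ≤ tentZ n := by
  unfold tentZ
  have hsub : Finset.range (m + 1) ⊆ Finset.range n := Finset.range_subset_range.mpr (by omega)
  have h1 : ∑ r ∈ Finset.range (m + 1), tentW n r = ∑ r ∈ Finset.range (m + 1), (r : ℝ) := by
    refine Finset.sum_congr rfl fun r hr => ?_
    rw [Finset.mem_range] at hr
    unfold tentW
    have : min r (n - 1 - r) = r := min_eq_left (by omega)
    rw [this]
  have h2 : ∑ r ∈ Finset.range (m + 1), (r : ℝ) = ((m : ℝ) * ((m : ℝ) + 1)) / 2 := by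
    have := Finset.sum_range_id_mul_two (m + 1)
    have h' : ((∑ i ∈ Finset.range (m + 1), i : ℕ) : ℝ) * 2 = ((m + 1) * (m + 1 - 1) : ℕ) := by exact_mod_cast this
    push_cast at h'
    linarith
  calc ((m : ℝ) * ((m : ℝ) + 1)) / 2 = ∑ r ∈ Finset.range (m + 1), tentW n r := by rw [h1, h2]
    _ ≤ ∑ r ∈ Finset.range n, tentW n r := Finset.sum_le_sum_of_subset_of_nonneg hsub fun r _ _ => tentW_nonneg n r

include hnm hm in
/-- `0 ≤ tentV n r ≤ 4`. [cite: Balaban1985Variational, (8) p.279] -/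
theorem tentV_mem (r : ℕ) : 0 ≤ tentV n r ∧ tentV n r ≤ 4 := by
  have hZ := tentZ_ge hnm
  have hm0 : (1 : ℝ) ≤ m := by exact_mod_cast hm
  have hZpos : 0 < tentZ n := lt_of_lt_of_le (by positivity) hZ
  unfold tentV
  refine ⟨div_nonneg (mul_nonneg (Nat.cast_nonneg _) (tentW_nonneg n r)) hZpos.le, ?_⟩
  rw [div_le_iff₀ hZpos]
  have hw := tentW_le hnm r
  have hn : (n : ℝ) = 2 * m + 1 := by rw [hnm]; push_cast; ring
  calc (n : ℝ) * tentW n r ≤ (2 * m + 1) * m := by rw [hn]; exact mul_le_mul_of_nonneg_left hw (by positivity)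
    _ ≤ 4 * (((m : ℝ) * ((m : ℝ) + 1)) / 2) := by nlinarith
    _ ≤ 4 * tentZ n := by linarith

include hnm hm in
/-- One-step Lipschitz bound of the tent: `|tentV n (r+1) − tentV n r| ≤ 12/n`. [folklore] -/
theorem abs_tentV_step_le (r : ℕ) : |tentV n (r + 1) - tentV n r| ≤ 12 / (n : ℝ) := by
  have hZ := tentZ_ge hnm
  have hm0 : (1 : ℝ) ≤ m := by exact_mod_cast hm
  have hZpos : 0 < tentZ n := lt_of_lt_of_le (by positivity) hZ
  have hn : (n : ℝ) = 2 * m + 1 := by rw [hnm]; push_cast; ring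
  have hnpos : (0 : ℝ) < n := by rw [hn]; positivity
  have hstep : |tentW n (r + 1) - tentW n r| ≤ 1 := by
    unfold tentW
    have hA : min (r + 1) (n - 1 - (r + 1)) ≤ min r (n - 1 - r) + 1 := by omega
    have hB : min r (n - 1 - r) ≤ min (r + 1) (n - 1 - (r + 1)) + 1 := by omega
    have hA' : ((min (r + 1) (n - 1 - (r + 1)) : ℕ) : ℝ) ≤ ((min r (n - 1 - r) : ℕ) : ℝ) + 1 := by exact_mod_cast hA
    have hB' : ((min r (n - 1 - r) : ℕ) : ℝ) ≤ ((min (r + 1) (n - 1 - (r + 1)) : ℕ) : ℝ) + 1 := by exact_mod_cast hB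
    rw [abs_le]; constructor <;> linarith
  have e : tentV n (r + 1) - tentV n r = (n : ℝ) * (tentW n (r + 1) - tentW n r) / tentZ n := by
    unfold tentV; ring
  rw [e, abs_div, abs_of_pos hZpos, abs_mul, abs_of_pos hnpos, div_le_div_iff₀ hZpos hnpos]
  calc (n : ℝ) * |tentW n (r + 1) - tentW n r| * n ≤ n * 1 * n := by
        exact mul_le_mul_of_nonneg_right (mul_le_mul_of_nonneg_left hstep hnpos.le) hnpos.le
    _ = (2 * m + 1) * (2 * m + 1) := by rw [hn]; ring
    _ ≤ 12 * (((m : ℝ) * ((m : ℝ) + 1)) / 2) := by nlinarith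
    _ ≤ 12 * tentZ n := by linarith

include hnm in
/-- The tent vanishes on the two boundary offsets. [folklore] -/
theorem tentV_zero_last : tentV n 0 = 0 ∧ tentV n (n - 1) = 0 := by
  unfold tentV tentW
  have h1 : min 0 (n - 1 - 0) = 0 := by omega
  have h2 : min (n - 1) (n - 1 - (n - 1)) = 0 := by omega
  rw [h1, h2]; simp

include hnm hm in
/-- The bump about the centre `c = m = (n−1)/2`: values in `[0,1]`, zero on the boundary offsets, one-step Lipschitz `1/m ≤ 3/n`. [folklore] -/
theorem bumpV_facts (r : ℕ) : 0 ≤ bumpV n m r ∧ bumpV n m r ≤ 1 ∧ bumpV n m 0 = 0 ∧ bumpV n m (n - 1) = 0 ∧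
    |bumpV n m (r + 1) - bumpV n m r| ≤ 3 / (n : ℝ) := by
  have hm0 : (1 : ℝ) ≤ m := by exact_mod_cast hm
  have hn : (n : ℝ) = 2 * m + 1 := by rw [hnm]; push_cast; ring
  have hR : ((n : ℝ) - 1) / 2 = m := by rw [hn]; ring
  unfold bumpV
  rw [hR]
  refine ⟨le_max_left _ _, max_le zero_le_one (by
      have : 0 ≤ |(r : ℝ) - (m : ℝ)| / m := by positivity
      linarith), ?_, ?_, ?_⟩
  · have : |((0 : ℕ) : ℝ) - (m : ℝ)| / m = 1 := by
      rw [Nat.cast_zero, zero_sub, abs_neg, abs_of_pos (by linarith), div_self (by linarith)]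
    rw [this, sub_self, max_self]
  · have e : ((n - 1 : ℕ) : ℝ) = 2 * m := by
      have : n - 1 = 2 * m := by omega
      rw [this]; push_cast; ring
    have : |((n - 1 : ℕ) : ℝ) - (m : ℝ)| / m = 1 := by
      rw [e, show (2 : ℝ) * m - m = m by ring, abs_of_pos (by linarith), div_self (by linarith)]
    rw [this, sub_self, max_self]
  · have hlip : |max 0 (1 - |((r + 1 : ℕ) : ℝ) - (m : ℝ)| / m) - max 0 (1 - |(r : ℝ) - (m : ℝ)| / m)| ≤ 1 / m := by
      rw [max_comm (0 : ℝ) (1 - |((r + 1 : ℕ) : ℝ) - (m : ℝ)| / m), max_comm (0 : ℝ) (1 - |(r : ℝ) - (m : ℝ)| / m)]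
      refine (abs_max_sub_max_le_abs (1 - |((r + 1 : ℕ) : ℝ) - (m : ℝ)| / m) (1 - |(r : ℝ) - (m : ℝ)| / m) 0).trans ?_
      rw [show (1 : ℝ) - |((r + 1 : ℕ) : ℝ) - m| / m - (1 - |(r : ℝ) - m| / m) = (|(r : ℝ) - m| - |((r + 1 : ℕ) : ℝ) - m|) / m by ring,
        abs_div, abs_of_pos (by linarith : (0 : ℝ) < m)]
      refine div_le_div_of_nonneg_right ?_ (by linarith)
      have := abs_abs_sub_abs_le ((r : ℝ) - m) (((r + 1 : ℕ) : ℝ) - m)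
      push_cast at this ⊢
      rw [show (r : ℝ) - m - ((r : ℝ) + 1 - m) = -1 by ring, abs_neg, abs_one] at this
      exact this
    refine hlip.trans ?_
    rw [div_le_div_iff₀ (by linarith) (by rw [hn]; positivity), hn]
    linarith

/-- **A HOSTED SHAPE VARIES BY AT MOST ITS IN-WINDOW LIPSCHITZ CONSTANT ALONG ONE STEP OF THE CYCLIC OFFSET** (given that it vanishes on the two boundary offsets): for
`ρ′ ≡ ρ + 1 (mod N)`, `|per N G♭ ρ′ − per N G♭ ρ| ≤ λ`. [folklore] -/
theorem abs_hosted_step_le {N nc : ℕ} (hN : N = n * nc) (hnc : 2 ≤ nc) (hn1 : 1 ≤ n) (G : ℕ → ℝ) {lam : ℝ} (hlam : 0 ≤ lam)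
    (hlip : ∀ r, r + 1 < n → |G (r + 1) - G r| ≤ lam) (h0 : G 0 = 0) (hlast : G (n - 1) = 0) {ρ ρ' : ℕ} (hρ : ρ' % N = (ρ + 1) % N) :
    |per N (fun r => if r < n then G r else 0) ρ' - per N (fun r => if r < n then G r else 0) ρ| ≤ lam := by
  have h2n := two_n_le hN hnc
  simp only [per]
  rw [hρ]
  rcases succ_mod hN hnc hn1 ρ with ⟨h1, h2⟩ | ⟨h1, h2⟩
  · rw [h1]
    set r := ρ % N with hr
    by_cases hlt : r + 1 < n
    · rw [if_pos hlt, if_pos (by omega)]; exact hlip r hlt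
    · by_cases heq : r + 1 = n
      · have hr' : r = n - 1 := by omega
        rw [if_neg hlt, if_pos (by omega), hr', hlast]; simpa using hlam
      · rw [if_neg hlt, if_neg (by omega)]; simpa using hlam
  · rw [h1, if_pos (by omega), h0, if_neg (by omega)]; simpa using hlam

include hnm hm in
/-- The hosted tent: `0 ≤ tS ≤ 4`, and one cyclic step changes it by at most `12/n`. [cite: Balaban1985Variational, (8) p.279] -/
theorem tS_facts {N nc : ℕ} (hN : N = n * nc) (hnc : 2 ≤ nc) (ρ : ℕ) :
    0 ≤ tS n N ρ ∧ tS n N ρ ≤ 4 ∧ ∀ ρ', ρ' % N = (ρ + 1) % N → |tS n N ρ' - tS n N ρ| ≤ 12 / (n : ℝ) := by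
  have hn1 : 1 ≤ n := by omega
  refine ⟨?_, ?_, fun ρ' hρ => ?_⟩
  · simp only [tS, per]; split_ifs
    · exact (tentV_mem hnm hm _).1
    · exact le_rfl
  · simp only [tS, per]; split_ifs
    · exact (tentV_mem hnm hm _).2
    · norm_num
  · exact abs_hosted_step_le hN hnc hn1 (tentV n) (by positivity) (fun r _ => abs_tentV_step_le hnm hm r)
      (tentV_zero_last hnm).1 (tentV_zero_last hnm).2 hρ

include hnm hm in
/-- The hosted bump about the centre: values in `[0,1]`, one cyclic step changes it by at most `3/n`. [cite: Balaban1987RG1, (0.3) p.252] -/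
theorem bumpS_facts {N nc : ℕ} (hN : N = n * nc) (hnc : 2 ≤ nc) (ρ : ℕ) :
    0 ≤ bumpS n N m ρ ∧ bumpS n N m ρ ≤ 1 ∧ ∀ ρ', ρ' % N = (ρ + 1) % N → |bumpS n N m ρ' - bumpS n N m ρ| ≤ 3 / (n : ℝ) := by
  have hn1 : 1 ≤ n := by omega
  refine ⟨?_, ?_, fun ρ' hρ => ?_⟩
  · simp only [bumpS, per]; split_ifs
    · exact (bumpV_facts hnm hm _).1
    · exact le_rfl
  · simp only [bumpS, per]; split_ifs
    · exact (bumpV_facts hnm hm _).2.1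
    · norm_num
  · exact abs_hosted_step_le hN hnc hn1 (bumpV n m) (by positivity) (fun r _ => (bumpV_facts hnm hm r).2.2.2.2)
      (bumpV_facts hnm hm 0).2.2.1 (bumpV_facts hnm hm 0).2.2.2.1 hρ

end OneD

end Summit.QuantumFields.YangMills.Theorems.AbelianEML.OneBlock

end
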